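import Summits.BirchSwinnertonDyer.Rank1Residual.GaloisImage.PadicRootCensus
import Literature.NumberTheory.EllipticCurves.SingularCubic
import Mathlib.NumberTheory.Padics.Hensel
import Mathlib.NumberTheory.Padics.RingHoms
import Mathlib.Topology.Algebra.Valued.NormedValued
import HarnessLib

/-!
# The TRIPLING TEST `Σ-TRI`, part 1: the computable check, Hensel in `y`, the cusp triple
# (cell `b2b-bsdres`, team n1011, ROW T-SIG3-TRI = r1 ROUTE-1 §46.5 ST-46a; seat p09 GEN 12)

HONEST FRAMING (cell `b2b-bsdres`, run/shared/lean/b2b/bsd-rank1-residual/, verbatim in every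
file): the goal of the cell is to DELETE the COMBINATION-SHAPED residual classes of the
Birch–Swinnerton-Dyer formula for ALL analytic-rank `≤ 1` elliptic curves over `ℚ` — "full BSD
formula for every rank `≤ 1` curve in class `C`" assembled STRICTLY from published theorems — so
that the rank-`≤ 1` remainder becomes exactly the CONSTRUCTION-SHAPED classes, which are TYPED
(missing-input `Prop`s), NOT attempted. This is not "finishing BSD". Team n1011 (N10/N11 = X4 ∧
`p = 3`, research route on the CONSTRUCTION-SHAPED class X4, §I N11). THIS FILE IS A TOOL:
theorems plus COMPUTABLE integer functions / `Bool`s (decider bookkeeping only: no `Prop`-valued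
definition, no named fact, no `sorry`); it closes nothing by itself, books nothing, moves no mark /
label / count.

## What

p10's THEOREM B (`TwistedWitness.exists_sha_ne_zero_of_congr_of_identityComponent`, FILE 8b of
`HOME/b2b-bsdres-n1011-p10/g8/L41-NOTE.md`) consumes, for each of the two `3`-congruent curves at
the place `3`, an integral model with CUSPIDAL reduction and a `3`-TORSION POINT `(a₀, b₀)` OF
NONSINGULAR REDUCTION on it ("`σ = E0`"). r1's ROUTE-1 §46.2 LEMMA Σ (the tripling test): such a
point exists iff for ANY `Q = (x₀, y) ∈ E₀(ℚ₃) ∖ E₁(ℚ₃)` one has `3Q ∈ E₂(ℚ₃) = 3·E₁(ℚ₃)`, a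
condition on the `3`-adic valuations of the two INTEGERS `Φ₃(x₀)`, `Ψ₃(x₀)`
(`x(3Q) = Φ₃(x₀)/Ψ₃(x₀)²`). THIS FILE (part 1 of 2):

* §1 the COMPUTABLE deciders: `val3` (a fuel-bounded `3`-adic valuation of an integer — no
  `padicValInt` inside the `Bool`, so that `decide` evaluates; `pow_val3_dvd` /
  `not_pow_val3_succ_dvd` say it IS the valuation), the integer polynomials `fInt` (the Weierstrass
  equation), `fyInt = 2y + a₁x + a₃`, `gInt = Ψ₂Sq = 4x³ + b₂x² + 2b₄x + b₆`, `psi3Int = Ψ₃`,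
  `prePsi4Int = preΨ₄`, `phi3Int = Φ₃ = x·Ψ₃² − preΨ₄·Ψ₂Sq` (Mathlib `Φ_three`), and
  **`sigmaTriCheckAt a₁ a₂ a₃ a₄ a₆ x₀ y₀`** := `[3 ∣ F(x₀,y₀)] ∧ [3 ∤ F_y(x₀,y₀)] ∧
  [Ψ₃(x₀) = 0 ∨ (Φ₃(x₀) ≠ 0 ∧ v₃(Φ₃(x₀)) + 4 ≤ 2·v₃(Ψ₃(x₀)))]`, **`sigmaTriCheck`** := the OR
  over `(x₀, y₀) ∈ {0,1,2}²` (r1's `x₀ = D⁻¹(1)` is an instance: `D(x₀) ≡ 1 (mod 3)` iff the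
  `y`-quadratic has two simple roots mod `3`);
* §2 `ℤ₃ ⊂ ℚ₃` as valuation integers (the `hv` input of `ReductionHomomorphism.lean`) and
  **Hensel in `y`** (`exists_padicInt_root_y`, Mathlib `hensels_lemma` over `R = ℤ`);
* §3 the CUSP TRIPLE for THEOREM B's `hcusp`: `map_singularModel` and
  `map_residue_eq_singularModel_of_zmod` (five coefficient identities over `ZMod 3`, `decide` per
  record, transported to the residue field of `ℤ₃`);
* §4 pilot `Bool`s: r1's suggested first THEOREM-B pair 2601h1 ~ 54621bf1 (ROUTE-1 §46.5 ST-46b)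
  passes `sigmaTriCheck` by `decide`.

Part 2 (`LocalThreeTorsionTriplingDecider`) proves the END
`exists_nonsingular_threeTorsion_of_sigmaTriCheck`: a `ℚ₃`-rational `3`-torsion point of
nonsingular reduction from `sigmaTriCheck = true` and `Δ ≠ 0`.

## References (provenance; nothing is cited as a fact)

* [SilvermanAEC2009] J. H. Silverman, *The Arithmetic of Elliptic Curves*, 2nd ed.: Ex. 3.7(d)
  (division polynomials), III.2.5 / III.1.4 (singular cubics), VII.2 (reduction).
* r1 ROUTE-1 §46 (`cells/n1011/ROUTE-1.md`, `route1/g34_S46.md`): LEMMA Σ and the census P46-a/b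
  (EVIDENCE: 51 126 / 51 126 additive curves; never a Literature fact).
-/

set_option autoImplicit false

noncomputable section

open scoped Classical
open Polynomial WeierstrassCurve Literature.NumberTheory.EllipticCurves

namespace Summit.BirchSwinnertonDyer.Rank1Residual.GaloisImage.SigmaTri

/-! ### §1. The computable deciders -/

/-- Fuel-bounded `3`-adic valuation of an integer (`0 ↦ 0`): strip factors of `3` while the fuel
lasts. [folklore] -/
def val3Aux : ℕ → ℤ → ℕ
  | 0, _ => 0
  | k + 1, n => if n % 3 = 0 ∧ n ≠ 0 then val3Aux k (n / 3) + 1 else 0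

/-- The `3`-adic valuation of a non-zero integer, computably (`val3 0 = 0`). [folklore] -/
def val3 (n : ℤ) : ℕ := val3Aux n.natAbs n

/-- `3 ^ val3Aux k n ∣ n`. [folklore] -/
theorem pow_val3Aux_dvd : ∀ (k : ℕ) (n : ℤ), (3 : ℤ) ^ val3Aux k n ∣ n
  | 0, n => by simp [val3Aux]
  | k + 1, n => by
      unfold val3Aux
      split_ifs with h
      · obtain ⟨m, rfl⟩ : (3 : ℤ) ∣ n := Int.dvd_of_emod_eq_zero h.1
        rw [Int.mul_ediv_cancel_left m (by norm_num : (3 : ℤ) ≠ 0), pow_succ, mul_comm]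
        exact mul_dvd_mul_left 3 (pow_val3Aux_dvd k m)
      · simp

/-- `3 ^ (val3Aux k n + 1) ∤ n` for `n ≠ 0` once the fuel `k ≥ |n|`. [folklore] -/
theorem not_pow_val3Aux_succ_dvd :
    ∀ (k : ℕ) (n : ℤ), n ≠ 0 → n.natAbs ≤ k → ¬ (3 : ℤ) ^ (val3Aux k n + 1) ∣ n
  | 0, n, hn, hk => absurd (Int.natAbs_eq_zero.mp (Nat.le_zero.mp hk)) hn
  | k + 1, n, hn, hk => by
      unfold val3Aux
      split_ifs with h
      · obtain ⟨m, rfl⟩ : (3 : ℤ) ∣ n := Int.dvd_of_emod_eq_zero h.1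
        have hm : m ≠ 0 := by rintro rfl; exact hn (by simp)
        rw [Int.mul_ediv_cancel_left m (by norm_num : (3 : ℤ) ≠ 0)]
        have hk' : m.natAbs ≤ k := by
          have h1 : (3 * m).natAbs = 3 * m.natAbs := by rw [Int.natAbs_mul]; rfl
          have h2 : 0 < m.natAbs := Int.natAbs_pos.mpr hm
          omega
        intro hdiv
        refine not_pow_val3Aux_succ_dvd k m hm hk' ?_
        rw [pow_succ, mul_comm] at hdiv
        exact (mul_dvd_mul_iff_left (by norm_num : (3 : ℤ) ≠ 0)).mp hdiv
      · rw [zero_add, pow_one]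
        intro hd
        exact h ⟨Int.emod_eq_zero_of_dvd hd, hn⟩

/-- `3 ^ val3 n ∣ n`. [folklore] -/
theorem pow_val3_dvd (n : ℤ) : (3 : ℤ) ^ val3 n ∣ n :=
  pow_val3Aux_dvd _ _

/-- `3 ^ (val3 n + 1) ∤ n` for `n ≠ 0`: `val3 n` IS the `3`-adic valuation. [folklore] -/
theorem not_pow_val3_succ_dvd {n : ℤ} (hn : n ≠ 0) : ¬ (3 : ℤ) ^ (val3 n + 1) ∣ n :=
  not_pow_val3Aux_succ_dvd _ _ hn le_rfl

/-- The Weierstrass equation `F(x, y) = y² + a₁xy + a₃y − (x³ + a₂x² + a₄x + a₆)` as an integer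
function. [folklore] -/
def fInt (a₁ a₂ a₃ a₄ a₆ x y : ℤ) : ℤ :=
  y ^ 2 + a₁ * x * y + a₃ * y - (x ^ 3 + a₂ * x ^ 2 + a₄ * x + a₆)

/-- `F_y(x, y) = 2y + a₁x + a₃`. [folklore] -/
def fyInt (a₁ a₃ x y : ℤ) : ℤ :=
  2 * y + a₁ * x + a₃

/-- `g(x) = Ψ₂Sq(x) = 4x³ + b₂x² + 2b₄x + b₆` (`= (2y + a₁x + a₃)²` on the curve). [folklore] -/
def gInt (a₁ a₂ a₃ a₄ a₆ x : ℤ) : ℤ :=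
  4 * x ^ 3 + (a₁ ^ 2 + 4 * a₂) * x ^ 2 + 2 * (2 * a₄ + a₁ * a₃) * x + (a₃ ^ 2 + 4 * a₆)

/-- `Ψ₃(x) = 3x⁴ + b₂x³ + 3b₄x² + 3b₆x + b₈`. [folklore] -/
def psi3Int (a₁ a₂ a₃ a₄ a₆ x : ℤ) : ℤ :=
  3 * x ^ 4 + (a₁ ^ 2 + 4 * a₂) * x ^ 3 + 3 * (2 * a₄ + a₁ * a₃) * x ^ 2 +
    3 * (a₃ ^ 2 + 4 * a₆) * x +
    (a₁ ^ 2 * a₆ + 4 * a₂ * a₆ - a₁ * a₃ * a₄ + a₂ * a₃ ^ 2 - a₄ ^ 2)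

/-- `preΨ₄(x) = 2x⁶ + b₂x⁵ + 5b₄x⁴ + 10b₆x³ + 10b₈x² + (b₂b₈ − b₄b₆)x + (b₄b₈ − b₆²)`
(`ψ₄ = preΨ₄ · ψ₂`). [folklore] -/
def prePsi4Int (a₁ a₂ a₃ a₄ a₆ x : ℤ) : ℤ :=
  let b₂ := a₁ ^ 2 + 4 * a₂
  let b₄ := 2 * a₄ + a₁ * a₃
  let b₆ := a₃ ^ 2 + 4 * a₆
  let b₈ := a₁ ^ 2 * a₆ + 4 * a₂ * a₆ - a₁ * a₃ * a₄ + a₂ * a₃ ^ 2 - a₄ ^ 2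
  2 * x ^ 6 + b₂ * x ^ 5 + 5 * b₄ * x ^ 4 + 10 * b₆ * x ^ 3 + 10 * b₈ * x ^ 2 +
    (b₂ * b₈ - b₄ * b₆) * x + (b₄ * b₈ - b₆ ^ 2)

/-- `Φ₃(x) = x·Ψ₃(x)² − preΨ₄(x)·Ψ₂Sq(x)` — the numerator of `x(3Q)` (Mathlib `Φ_three`).
[folklore] -/
def phi3Int (a₁ a₂ a₃ a₄ a₆ x : ℤ) : ℤ :=
  x * psi3Int a₁ a₂ a₃ a₄ a₆ x ^ 2 - prePsi4Int a₁ a₂ a₃ a₄ a₆ x * gInt a₁ a₂ a₃ a₄ a₆ x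

/-- **The tripling test at a residue pair `(x₀, y₀)`**: `(x₀, y₀)` is a SIMPLE root of the
equation mod `3` in the `y`-direction, and either `Ψ₃(x₀) = 0` or
`v₃(Φ₃(x₀)) + 4 ≤ 2 v₃(Ψ₃(x₀))` (i.e. `v₃(x(3Q)) ≤ -4`: `3Q ∈ E₂(ℚ₃)`). [folklore] -/
def sigmaTriCheckAt (a₁ a₂ a₃ a₄ a₆ x₀ y₀ : ℤ) : Bool :=
  (fInt a₁ a₂ a₃ a₄ a₆ x₀ y₀ % 3 == 0) && !(fyInt a₁ a₃ x₀ y₀ % 3 == 0) &&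
    ((psi3Int a₁ a₂ a₃ a₄ a₆ x₀ == 0) ||
      (!(phi3Int a₁ a₂ a₃ a₄ a₆ x₀ == 0) &&
        decide (val3 (phi3Int a₁ a₂ a₃ a₄ a₆ x₀) + 4 ≤ 2 * val3 (psi3Int a₁ a₂ a₃ a₄ a₆ x₀))))

/-- **The tripling test `Σ-TRI`**: some residue pair `(x₀, y₀) ∈ {0,1,2}²` passes
`sigmaTriCheckAt`. [folklore] -/
def sigmaTriCheck (a₁ a₂ a₃ a₄ a₆ : ℤ) : Bool :=
  [(0 : ℤ), 1, 2].any fun x₀ => [(0 : ℤ), 1, 2].any fun y₀ => sigmaTriCheckAt a₁ a₂ a₃ a₄ a₆ x₀ y₀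

/-! ### §2. `ℤ₃ ⊂ ℚ₃` as valuation integers; Hensel in `y` -/

/-- `ℤ₃ ⊂ ℚ₃` is the ring of integers of the norm valuation of `ℚ₃` (the input
`hv : v.Integers R` of `ReductionHomomorphism.lean`; the tree's `padicInt_valuationIntegers` at
`p = 3`, two lines, not worth its import chain). [folklore] -/
theorem padicInt_valuationIntegers_three :
    (NormedField.valuation (K := ℚ_[3])).Integers ℤ_[3] where
  hom_inj := fun x y h => Subtype.ext h
  map_le_one x := by
    change ‖(x : ℚ_[3])‖₊ ≤ 1
    rw [← NNReal.coe_le_coe, coe_nnnorm, NNReal.coe_one]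
    exact x.2
  exists_of_le_one r hr := by
    change ‖r‖₊ ≤ 1 at hr
    rw [← NNReal.coe_le_coe, coe_nnnorm, NNReal.coe_one] at hr
    exact ⟨⟨r, hr⟩, rfl⟩

/-- **Hensel in `y`**: if `3 ∣ F(x₀, y₀)` and `3 ∤ F_y(x₀, y₀)` for integers `x₀, y₀`, there is
`y ∈ ℤ₃` with `F(x₀, y) = 0`, `y ≡ y₀ (mod 3)` and `2y + a₁x₀ + a₃` a unit. [folklore] -/
theorem exists_padicInt_root_y (a₁ a₂ a₃ a₄ a₆ x₀ y₀ : ℤ)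
    (hF : (3 : ℤ) ∣ fInt a₁ a₂ a₃ a₄ a₆ x₀ y₀) (hFy : ¬ (3 : ℤ) ∣ fyInt a₁ a₃ x₀ y₀) :
    ∃ y : ℤ_[3], y ^ 2 + ((a₁ * x₀ + a₃ : ℤ) : ℤ_[3]) * y -
        ((x₀ ^ 3 + a₂ * x₀ ^ 2 + a₄ * x₀ + a₆ : ℤ) : ℤ_[3]) = 0 ∧
      ‖2 * y + ((a₁ * x₀ + a₃ : ℤ) : ℤ_[3])‖ = 1 ∧ ‖y - (y₀ : ℤ_[3])‖ < 1 := by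
  have hfb : fInt a₁ a₂ a₃ a₄ a₆ x₀ y₀ =
      y₀ ^ 2 + (a₁ * x₀ + a₃) * y₀ - (x₀ ^ 3 + a₂ * x₀ ^ 2 + a₄ * x₀ + a₆) := by
    simp only [fInt]; ring
  have hfyb : fyInt a₁ a₃ x₀ y₀ = 2 * y₀ + (a₁ * x₀ + a₃) := by
    simp only [fyInt]; ring
  rw [hfb] at hF
  rw [hfyb] at hFy
  generalize (a₁ * x₀ + a₃ : ℤ) = b at hF hFy ⊢
  generalize (x₀ ^ 3 + a₂ * x₀ ^ 2 + a₄ * x₀ + a₆ : ℤ) = c at hF ⊢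
  set G : ℤ[X] := X ^ 2 + C b * X - C c with hGdef
  have hG : ∀ z : ℤ_[3], aeval z G = z ^ 2 + (b : ℤ_[3]) * z - (c : ℤ_[3]) := by
    intro z
    simp only [hGdef, map_sub, map_add, map_mul, map_pow, aeval_X, eq_intCast, map_intCast]
  have hG' : ∀ z : ℤ_[3], aeval z (derivative G) = 2 * z + (b : ℤ_[3]) := by
    intro z
    have hd : derivative G = C (2 : ℤ) * X + C b := by
      simp only [hGdef, derivative_sub, derivative_add, derivative_X_pow, derivative_mul,
        derivative_C, derivative_X, zero_mul, zero_add, mul_one, sub_zero, Nat.cast_ofNat]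
      simp only [map_ofNat]
      ring
    rw [hd]
    simp only [map_add, map_mul, aeval_X, eq_intCast, map_intCast, map_ofNat]
  have h1 : ‖aeval (y₀ : ℤ_[3]) G‖ < 1 := by
    rw [hG, show (y₀ : ℤ_[3]) ^ 2 + (b : ℤ_[3]) * (y₀ : ℤ_[3]) - (c : ℤ_[3]) =
        ((y₀ ^ 2 + b * y₀ - c : ℤ) : ℤ_[3]) by push_cast; ring]
    exact (PadicInt.norm_int_lt_one_iff_dvd _).mpr (by exact_mod_cast hF)
  have h2 : ‖aeval (y₀ : ℤ_[3]) (derivative G)‖ = 1 := by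
    rw [hG', show 2 * (y₀ : ℤ_[3]) + (b : ℤ_[3]) = ((2 * y₀ + b : ℤ) : ℤ_[3]) by push_cast; ring]
    refine le_antisymm (PadicInt.norm_le_one _) (not_lt.mp fun hlt => hFy ?_)
    exact_mod_cast (PadicInt.norm_int_lt_one_iff_dvd _).mp hlt
  have hnorm : ‖aeval (y₀ : ℤ_[3]) G‖ < ‖aeval (y₀ : ℤ_[3]) (derivative G)‖ ^ 2 := by
    rw [h2, one_pow]; exact h1
  obtain ⟨y, hy, hdist, hder, -⟩ := hensels_lemma hnorm
  refine ⟨y, by rw [← hG]; exact hy, by rw [← hG', hder, h2], by rw [h2] at hdist; exact hdist⟩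

/-! ### §3. The cusp triple (for THEOREM B's `hcusp`) -/

/-- `singularModel` commutes with ring maps (its coefficients are polynomials in
`x₀, y₀, α₁, α₂`). [folklore] -/
theorem map_singularModel {k k' : Type*} [Field k] [Field k'] (f : k →+* k')
    (x₀ y₀ α₁ α₂ : k) :
    (singularModel x₀ y₀ α₁ α₂).map f = singularModel (f x₀) (f y₀) (f α₁) (f α₂) := by
  ext
  · simp only [map_a₁, singularModel.a₁_eq, map_neg, map_add]
  · simp only [map_a₂, singularModel.a₂_eq, map_sub, map_neg, map_mul, map_ofNat]
  · simp only [map_a₃, singularModel.a₃_eq, map_add, map_mul, map_neg, map_ofNat]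
  · simp only [map_a₄, singularModel.a₄_eq, map_add, map_mul, map_neg, map_ofNat, map_pow]
  · simp only [map_a₆, singularModel.a₆_eq, map_sub, map_add, map_mul, map_neg, map_pow]

/-- **The cusp triple, `decide`-shaped.** If the integer model reduces ON THE NOSE to
`singularModel x̄ ȳ α α` over `ZMod 3` (five coefficient identities, `decide` per record), then
its `ℤ₃`-model reduces to `singularModel` over the residue field of `ℤ₃`, along the canonical
`ZMod 3 → 𝔽`. [folklore] -/
theorem map_residue_eq_singularModel_of_zmod (a₁ a₂ a₃ a₄ a₆ : ℤ) {xc yc α : ZMod 3}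
    (h : (⟨a₁, a₂, a₃, a₄, a₆⟩ : WeierstrassCurve ℤ).map (Int.castRingHom (ZMod 3)) =
      singularModel xc yc α α) :
    ((⟨a₁, a₂, a₃, a₄, a₆⟩ : WeierstrassCurve ℤ).map (Int.castRingHom ℤ_[3])).map
        (IsLocalRing.residue ℤ_[3]) =
      singularModel ((PadicInt.residueField (p := 3)).symm xc)
        ((PadicInt.residueField (p := 3)).symm yc) ((PadicInt.residueField (p := 3)).symm α)
        ((PadicInt.residueField (p := 3)).symm α) := by
  haveI : Fact (Nat.Prime 3) := ⟨Nat.prime_three⟩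
  set ι : ZMod 3 →+* IsLocalRing.ResidueField ℤ_[3] :=
    ((PadicInt.residueField (p := 3)).symm : ZMod 3 ≃+* _).toRingHom with hι
  have hcomp : (IsLocalRing.residue ℤ_[3]).comp (Int.castRingHom ℤ_[3]) =
      ι.comp (Int.castRingHom (ZMod 3)) := RingHom.ext_int _ _
  rw [WeierstrassCurve.map_map, hcomp, ← WeierstrassCurve.map_map, h, map_singularModel]
  rfl

/-! ### §4. Pilot `Bool`s: r1's suggested first THEOREM-B pair 2601h1 ~ 54621bf1 (ROUTE-1 §46.5 ST-46b) -/

/-- 2601h1 = `[1, -1, 0, -59877, -3934008]` (additive IV* at `3`) passes the tripling test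
(witness `(x₀, y₀) = (1, 0)`: `v₃(Ψ₃(1)) = 3`, `v₃(Φ₃(1)) = 0`). [folklore] -/
theorem sigmaTriCheck_2601h1 : sigmaTriCheck 1 (-1) 0 (-59877) (-3934008) = true := by
  decide

/-- 54621bf1 = `[0, 0, 1, -73695, 6034392]` (additive IV at `3`) passes the tripling test
(witness `(x₀, y₀) = (0, 0)`: `v₃(Ψ₃(0)) = 2`, `v₃(Φ₃(0)) = 0`). [folklore] -/
theorem sigmaTriCheck_54621bf1 : sigmaTriCheck 0 0 1 (-73695) 6034392 = true := by
  decide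

end Summit.BirchSwinnertonDyer.Rank1Residual.GaloisImage.SigmaTri

end
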